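import Mathlib.MeasureTheory.Integral.IntervalIntegral.Periodic
import Mathlib.Analysis.Normed.Group.AddCircle
import Mathlib.Analysis.SpecialFunctions.Log.Basic
import Literature.NumberTheory.ConnesConsani2023.RiemannRochSpecZProofs
import HarnessLib

/-!
# Connes–Consani, Riemann–Roch for the ring `ℤ` (2024) — proof of Proposition 4.2 (`dim_𝕊 U(1)_λ`)

A. Connes, C. Consani, *Riemann–Roch for the ring `ℤ`*, C. R. Math. 362 (2024) 229–235 = arXiv:2306.00456
[bib: `ConnesConsani2024RiemannRochZ`], Proposition 4.2 (p. 5): for the tolerant `𝕊`-module `U(1)_λ = (ℝ/ℤ, d)_λ`,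
`dim_𝕊 U(1)_λ = m` if `2^{-m-1} ≤ λ < 2^{-m}` and `= 0` if `λ ≥ 1/2`, where `dim_𝕊` (`sTolDim`, typed in
`RiemannRochSpecZ.lean`) uses subset sums (`α_j ∈ {0,1}`) instead of the signed sums of the 2023 paper.

We FOLLOW THE PRINTED PROOF (p. 5), which is the base-`(-2)` analogue of 2023 Prop. 4.1
(`RiemannRochSpecZProofs.lean`, whose covering/measure argument and circle API we reuse):
* `λ ≥ 1/2`: `F = ∅` (`sTolDim_eq_zero`);
* lower bound: the `2^{#F}` subset sums are `λ`-dense, so `2^{#F} · 2λ ≥ 1` (`one_le_two_pow_card_mul`,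
  Haar measure), whence `#F ≥ m` when `λ < 2^{-m}` (`le_card_of_sTolGenerates`);
* upper bound: `F(m) = {(-2)^{-j} : 1 ≤ j ≤ m}` is separated (`inv_two_pow_le_dist`) and every `y` is within
  `2^{-m-1}` of a subset sum, by the negabinary expansion (Lemma 4.1 in the form `exists_negabinary`:
  `q = Σ b_i (-2)^i + c(-2)^m`, the carry `c` being invisible in `ℝ/ℤ`) applied to `q = round((-2)^m y)`
  (`sTolGenerates_Fm2`).

Cell `pub-rhdoor`, seat cc-2; used by `RiemannRochRingZTheorem.lean` (Thm. 5.1).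
-/

noncomputable section

open Set MeasureTheory

namespace Literature.NumberTheory.ConnesConsani2023

section General

variable {A : Type*} [SeminormedAddCommGroup A]

/-- A generating set bounds `dim_𝕊 (A,d)_λ` from above. [folklore] -/
theorem sTolDim_le_card {lam : ℝ} {F : Finset A} (h : STolGenerates lam F) :
    sTolDim A lam ≤ F.card :=
  Nat.sInf_le ⟨F, rfl, h⟩

/-- If some generating set exists and every generating set has `≥ k` elements then `dim_𝕊 (A,d)_λ ≥ k`.
[folklore] -/
theorem le_sTolDim {lam : ℝ} {k : ℕ} (hne : ∃ F : Finset A, STolGenerates lam F)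
    (h : ∀ F : Finset A, STolGenerates lam F → k ≤ F.card) : k ≤ sTolDim A lam := by
  obtain ⟨F, hF⟩ := hne
  have hmem : sTolDim A lam ∈ {k : ℕ | ∃ F : Finset A, F.card = k ∧ STolGenerates lam F} :=
    Nat.sInf_mem ⟨F.card, F, rfl, hF⟩
  obtain ⟨F₀, hF₀, hgen⟩ := hmem
  rw [← hF₀]
  exact h F₀ hgen

end General

/-! ## Negabinary expansion with carry (Lemma 4.1 in the form needed) -/

/-- Negabinary expansion with carry: every integer is `Σ_{i<m} b_i (-2)^i + c (-2)^m` with `b_i ∈ {0,1}`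
(2024 Lemma 4.1 — the subset sums of `G(m) = {(-2)^j : j < m}` form an interval of length `2^m` — in the
form needed). [cite: ConnesConsani2024RiemannRochZ, Lemma 4.1 p. 5] -/
theorem exists_negabinary (m : ℕ) (q : ℤ) :
    ∃ b : ℕ → ℤ, (∀ i, b i = 0 ∨ b i = 1) ∧
      ∃ c : ℤ, q = (∑ i ∈ Finset.range m, b i * (-2) ^ i) + c * (-2) ^ m := by
  induction m generalizing q with
  | zero => exact ⟨fun _ => 0, fun _ => Or.inl rfl, q, by simp⟩
  | succ m ih =>
    -- `q = b₀ + (-2) q'` with `b₀ = q mod 2`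
    set b0 : ℤ := q % 2 with hb0
    set q' : ℤ := (b0 - q) / 2 with hq'
    have hb0' : b0 = 0 ∨ b0 = 1 := by omega
    have hdiv : q = b0 + (-2) * q' := by omega
    obtain ⟨b', hb', c, hc⟩ := ih q'
    let b : ℕ → ℤ := fun i => if i = 0 then b0 else b' (i - 1)
    have hbz : b 0 = b0 := by simp [b]
    have hbS : ∀ i, b (i + 1) = b' i := fun i => by simp [b]
    refine ⟨b, ?_, c, ?_⟩
    · intro i
      cases i with
      | zero => rw [hbz]; exact hb0'
      | succ i => rw [hbS]; exact hb' i
    · rw [Finset.sum_range_succ']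
      simp only [hbS, hbz, pow_zero, mul_one]
      have hS : ∑ i ∈ Finset.range m, b' i * (-2 : ℤ) ^ (i + 1)
          = (-2) * ∑ i ∈ Finset.range m, b' i * (-2) ^ i := by
        rw [Finset.mul_sum]
        exact Finset.sum_congr rfl fun i _ => by ring
      linear_combination hdiv + (-2) * hc - hS

/-! ## `λ ≥ 1/2` -/

/-- For `λ ≥ 1/2` the empty set generates `U(1)_λ` ("by convention `Σ_∅ = 0`"). [cite: ConnesConsani2024RiemannRochZ, Prop. 4.2 p. 5] -/
theorem sTolGenerates_empty {lam : ℝ} (h : 1 / 2 ≤ lam) :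
    STolGenerates (A := AddCircle (1 : ℝ)) lam ∅ := by
  refine ⟨by simp, fun x => ⟨∅, Finset.Subset.refl _, ?_⟩⟩
  rw [Finset.sum_empty, dist_zero_right]
  exact (norm_le_half x).trans h

/-- Prop. 4.2, case `λ ≥ 1/2`: `dim_𝕊 U(1)_λ = 0`. [cite: ConnesConsani2024RiemannRochZ, Prop. 4.2 p. 5] -/
theorem sTolDim_eq_zero {lam : ℝ} (h : 1 / 2 ≤ lam) : sTolDim (AddCircle (1 : ℝ)) lam = 0 :=
  Nat.le_zero.mp (by simpa using sTolDim_le_card (sTolGenerates_empty h))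

/-! ## Lower bound -/

/-- The `2^{#F}` subset sums of a generating set are `λ`-dense in `ℝ/ℤ`, hence `1 ≤ 2^{#F} · 2λ` when
`2λ ≤ 1` ("there are at most `2^k` elements of the form `Σ_F α_j j`, `α_j ∈ {0,1}` … unless `2^k · 2λ ≥ 1`").
[cite: ConnesConsani2024RiemannRochZ, Prop. 4.2 p. 5] -/
theorem one_le_two_pow_card_mul {lam : ℝ} (hlam : 0 ≤ lam) (h2 : 2 * lam ≤ 1)
    {F : Finset (AddCircle (1 : ℝ))} (hF : STolGenerates lam F) :
    (1 : ℝ) ≤ 2 ^ F.card * (2 * lam) := by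
  classical
  let T : Finset (AddCircle (1 : ℝ)) := F.powerset.image fun Z => ∑ j ∈ Z, j
  have hTcard : (T.card : ℝ) ≤ 2 ^ F.card := by
    have h1 : T.card ≤ F.powerset.card := Finset.card_image_le
    rw [Finset.card_powerset] at h1
    exact_mod_cast h1
  have hcover : (univ : Set (AddCircle (1 : ℝ))) ⊆ ⋃ t ∈ T, Metric.closedBall t lam := by
    intro x _
    obtain ⟨Z, hZ, hdist⟩ := hF.2 x
    refine Set.mem_iUnion₂.mpr ⟨∑ j ∈ Z, j, Finset.mem_image.mpr ⟨Z, Finset.mem_powerset.mpr hZ, rfl⟩, ?_⟩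
    rw [Metric.mem_closedBall]
    exact hdist
  have hmeas : (1 : ENNReal) ≤ (T.card : ENNReal) * ENNReal.ofReal (2 * lam) := by
    calc (1 : ENNReal) = volume (univ : Set (AddCircle (1 : ℝ))) := by
            rw [AddCircle.measure_univ]; simp
      _ ≤ volume (⋃ t ∈ T, Metric.closedBall t lam) := measure_mono hcover
      _ ≤ ∑ t ∈ T, volume (Metric.closedBall t lam) := measure_biUnion_finset_le T _
      _ = ∑ t ∈ T, ENNReal.ofReal (2 * lam) := by
            refine Finset.sum_congr rfl fun t _ => ?_
            rw [AddCircle.volume_closedBall, min_eq_right h2]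
      _ = (T.card : ENNReal) * ENNReal.ofReal (2 * lam) := by
            rw [Finset.sum_const, nsmul_eq_mul]
  have hmeas' : ENNReal.ofReal 1 ≤ ENNReal.ofReal (T.card * (2 * lam)) := by
    rw [ENNReal.ofReal_one, ENNReal.ofReal_mul (Nat.cast_nonneg _), ENNReal.ofReal_natCast]
    exact hmeas
  rw [ENNReal.ofReal_le_ofReal_iff (by positivity)] at hmeas'
  calc (1 : ℝ) ≤ T.card * (2 * lam) := hmeas'
    _ ≤ 2 ^ F.card * (2 * lam) := by gcongr

/-- Lower bound of Prop. 4.2: if `λ < 2^{-m}` a generating set has at least `m` elements. [cite: ConnesConsani2024RiemannRochZ, Prop. 4.2 p. 5] -/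
theorem le_card_of_sTolGenerates {lam : ℝ} (hlam : 0 ≤ lam) {m : ℕ} (hhi : lam < 1 / (2 : ℝ) ^ m)
    {F : Finset (AddCircle (1 : ℝ))} (hF : STolGenerates lam F) : m ≤ F.card := by
  rcases Nat.eq_zero_or_pos m with hm | hm
  · omega
  have h2m : (0 : ℝ) < 2 ^ m := by positivity
  have h2le : (2 : ℝ) ≤ 2 ^ m := by
    calc (2 : ℝ) = 2 ^ 1 := (pow_one _).symm
      _ ≤ 2 ^ m := pow_le_pow_right₀ (by norm_num) hm
  rw [lt_div_iff₀ h2m] at hhi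
  have h2 : 2 * lam ≤ 1 := by nlinarith
  have h1 := one_le_two_pow_card_mul hlam h2 hF
  -- `1 ≤ 2^k · 2λ` and `λ 2^m < 1` force `2^m < 2^{k+1}`, i.e. `m ≤ k`
  have hlt : (2 : ℝ) ^ m < 2 ^ (F.card + 1) := by
    have : (1 : ℝ) * 2 ^ m ≤ 2 ^ F.card * (2 * lam) * 2 ^ m := by gcongr
    rw [pow_succ]
    nlinarith
  have := (pow_lt_pow_iff_right₀ (by norm_num : (1 : ℝ) < 2)).mp hlt
  omega

/-! ## Upper bound: the set `F(m) = {(-2)^{-j} : 1 ≤ j ≤ m}` -/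

/-- The projection `ℝ → ℝ/ℤ` commutes with finite sums. [folklore] -/
private theorem coe_finset_sum' {ι : Type*} (s : Finset ι) (f : ι → ℝ) :
    (((∑ i ∈ s, f i : ℝ)) : AddCircle (1 : ℝ)) = ∑ i ∈ s, ((f i : ℝ) : AddCircle (1 : ℝ)) :=
  map_sum (QuotientAddGroup.mk' (AddSubgroup.zmultiples (1 : ℝ))) f s

section Upper

variable (m : ℕ)

/-- `r2 i = (-2)^i / (-2)^m = (-2)^{-(m-i)}`, `i < m`: the elements `(-2)^{-j}`, `1 ≤ j ≤ m`, of `F(m)` as reals.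
[cite: ConnesConsani2024RiemannRochZ, Prop. 4.2 p. 5] -/
private def r2 (i : Fin m) : ℝ := (-2 : ℝ) ^ (i : ℕ) / (-2) ^ m

/-- The points `(-2)^{-j}`, `1 ≤ j ≤ m`, of `ℝ/ℤ` (the set `F(m)` of the proof of Prop. 4.2). [cite: ConnesConsani2024RiemannRochZ, Prop. 4.2 p. 5] -/
private def e2 (i : Fin m) : AddCircle (1 : ℝ) := ((r2 m i : ℝ) : AddCircle (1 : ℝ))

/-- Separation: for `i ≠ j` and every integer `k`, `|(-2)^{i-m} - (-2)^{j-m} - k| ≥ 2^{-m}` (the numerator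
`(-2)^i - (-2)^j - k(-2)^m` is a non-zero integer). [cite: ConnesConsani2024RiemannRochZ, Prop. 4.2 p. 5] -/
private theorem inv_two_pow_le {i j : Fin m} (h : i ≠ j) (k : ℤ) :
    1 / (2 : ℝ) ^ m ≤ |r2 m i - r2 m j - k| := by
  have hne : (i : ℕ) ≠ (j : ℕ) := fun e => h (Fin.ext e)
  have h2m : (0 : ℝ) < 2 ^ m := by positivity
  have hpm : ((-2 : ℝ) ^ m) ≠ 0 := pow_ne_zero _ (by norm_num)
  -- the integer `D = (-2)^i - (-2)^j - k (-2)^m` is nonzero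
  set D : ℤ := (-2) ^ (i : ℕ) - (-2) ^ (j : ℕ) - k * (-2) ^ m with hD
  have hDne : D ≠ 0 := by
    intro h0
    -- absolute values: |(-2)^i - (-2)^j| < 2^m and is nonzero
    have hi := i.2; have hj := j.2
    have h1 : ((-2 : ℤ) ^ (i : ℕ) - (-2) ^ (j : ℕ)) = k * (-2) ^ m := by linarith
    have habs_i : |(-2 : ℤ) ^ (i : ℕ)| = 2 ^ (i : ℕ) := by rw [abs_pow]; norm_num
    have habs_j : |(-2 : ℤ) ^ (j : ℕ)| = 2 ^ (j : ℕ) := by rw [abs_pow]; norm_num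
    have habs_m : |(-2 : ℤ) ^ m| = 2 ^ m := by rw [abs_pow]; norm_num
    rcases eq_or_ne k 0 with hk | hk
    · rw [hk, zero_mul, sub_eq_zero] at h1
      have := congrArg (fun z : ℤ => |z|) h1
      simp only [habs_i, habs_j] at this
      exact hne (Nat.pow_right_injective (le_refl 2) (by exact_mod_cast this))
    · -- `|k (-2)^m| ≥ 2^m > 2^i + 2^j ≥ |(-2)^i - (-2)^j|`
      have hk1 : 1 ≤ |k| := Int.one_le_abs hk
      have hlhs : |(-2 : ℤ) ^ (i : ℕ) - (-2) ^ (j : ℕ)| ≤ 2 ^ (i : ℕ) + 2 ^ (j : ℕ) := by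
        calc |(-2 : ℤ) ^ (i : ℕ) - (-2) ^ (j : ℕ)| ≤ |(-2 : ℤ) ^ (i : ℕ)| + |(-2) ^ (j : ℕ)| :=
              abs_sub _ _
          _ = 2 ^ (i : ℕ) + 2 ^ (j : ℕ) := by rw [habs_i, habs_j]
      have hsum : (2 : ℤ) ^ (i : ℕ) + 2 ^ (j : ℕ) < 2 ^ m := by
        rcases lt_or_gt_of_ne hne with hlt | hgt
        · have h1 : (2 : ℤ) ^ (i : ℕ) < 2 ^ (j : ℕ) := pow_lt_pow_right₀ (by norm_num) hlt
          have h2 : (2 : ℤ) ^ ((j : ℕ) + 1) ≤ 2 ^ m := pow_le_pow_right₀ (by norm_num) hj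
          rw [pow_succ] at h2; linarith
        · have h1 : (2 : ℤ) ^ (j : ℕ) < 2 ^ (i : ℕ) := pow_lt_pow_right₀ (by norm_num) hgt
          have h2 : (2 : ℤ) ^ ((i : ℕ) + 1) ≤ 2 ^ m := pow_le_pow_right₀ (by norm_num) hi
          rw [pow_succ] at h2; linarith
      have hrhs : (2 : ℤ) ^ m ≤ |k * (-2) ^ m| := by
        rw [abs_mul, habs_m]
        nlinarith [pow_pos (by norm_num : (0 : ℤ) < 2) m]
      rw [h1] at hlhs
      linarith
  have hD1 : (1 : ℝ) ≤ |(D : ℝ)| := by exact_mod_cast Int.one_le_abs hDne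
  have hexpr : r2 m i - r2 m j - k = (D : ℝ) / (-2) ^ m := by
    unfold r2; rw [hD]; push_cast; field_simp
  rw [hexpr, abs_div, abs_pow, abs_neg, abs_two, le_div_iff₀ h2m, div_mul_cancel₀ _ h2m.ne']
  exact hD1

/-- The points `(-2)^{-j}`, `1 ≤ j ≤ m`, are distinct in `ℝ/ℤ`. [folklore] -/
private theorem e2_injective : Function.Injective (e2 m) := by
  intro i j hij
  by_contra hne
  -- `e2 i = e2 j` means `r2 i - r2 j ∈ ℤ`
  have h0 : ((r2 m i - r2 m j : ℝ) : AddCircle (1 : ℝ)) = 0 := by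
    rw [AddCircle.coe_sub]; exact sub_eq_zero.mpr hij
  obtain ⟨k, hk⟩ := (AddCircle.coe_eq_zero_iff (1 : ℝ)).mp h0
  have h := inv_two_pow_le m hne k
  rw [← hk, zsmul_eq_mul, mul_one, sub_self, abs_zero] at h
  have : (0 : ℝ) < 1 / 2 ^ m := by positivity
  linarith

/-- Distinct points of `F(m)` are at distance `≥ 2^{-m}` in `ℝ/ℤ` (the paper states the minimal distance
as `3 · 2^{-m}` between real representatives; `2^{-m} > λ` is what the argument uses). [cite: ConnesConsani2024RiemannRochZ, Prop. 4.2 p. 5] -/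
private theorem inv_two_pow_le_dist {i j : Fin m} (h : i ≠ j) :
    1 / (2 : ℝ) ^ m ≤ dist (e2 m i) (e2 m j) := by
  rw [dist_eq_norm, e2, e2, ← AddCircle.coe_sub, AddCircle.norm_eq]
  simp only [inv_one, one_mul, mul_one]
  exact inv_two_pow_le m h _

/-- The set `F(m) = {(-2)^{-j} : j = 1, …, m} ⊂ U(1)` of the proof of Prop. 4.2. [cite: ConnesConsani2024RiemannRochZ, Prop. 4.2 p. 5] -/
private def Fm2 : Finset (AddCircle (1 : ℝ)) := Finset.univ.image (e2 m)

/-- `#F(m) = m`. [folklore] -/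
private theorem card_Fm2 : (Fm2 m).card = m := by
  rw [Fm2, Finset.card_image_of_injective _ (e2_injective m), Finset.card_univ, Fintype.card_fin]

/-- `F(m)` generates `U(1)_λ` over `𝕊` for `2^{-m-1} ≤ λ < 2^{-m}`: separation from `λ < 2^{-m}`, density from
the negabinary expansion of `q = round((-2)^m y)` ("`d(x, q·(-2)^{-m}) ≤ 2^{-m-1} = λ`"). [cite: ConnesConsani2024RiemannRochZ, Prop. 4.2 p. 5] -/
theorem sTolGenerates_Fm2 {lam : ℝ} (hlo : 1 / (2 : ℝ) ^ (m + 1) ≤ lam)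
    (hhi : lam < 1 / (2 : ℝ) ^ m) : STolGenerates lam (Fm2 m) := by
  classical
  refine ⟨?_, ?_⟩
  · intro x hx y hy hxy
    obtain ⟨i, -, rfl⟩ := Finset.mem_image.mp hx
    obtain ⟨j, -, rfl⟩ := Finset.mem_image.mp hy
    have hij : i ≠ j := fun h => hxy (by rw [h])
    exact hhi.trans_le (inv_two_pow_le_dist m hij)
  · intro x
    obtain ⟨y, rfl⟩ := QuotientAddGroup.mk_surjective x
    have hpm : ((-2 : ℝ) ^ m) ≠ 0 := pow_ne_zero _ (by norm_num)
    have h2m : (0 : ℝ) < 2 ^ m := by positivity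
    set q : ℤ := round (((-2 : ℝ) ^ m) * y) with hq
    obtain ⟨b, hb, c, hc⟩ := exists_negabinary m q
    -- the subset `Z = {e2 i : b i = 1}`
    let S : Finset (Fin m) := Finset.univ.filter fun i => b i = 1
    refine ⟨S.image (e2 m), ?_, ?_⟩
    · intro z hz
      obtain ⟨i, -, rfl⟩ := Finset.mem_image.mp hz
      exact Finset.mem_image.mpr ⟨i, Finset.mem_univ _, rfl⟩
    · set s : ℝ := ∑ i : Fin m, (b i : ℝ) * r2 m i with hs
      have hsum : ∑ j ∈ S.image (e2 m), j = ((s : ℝ) : AddCircle (1 : ℝ)) := by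
        rw [Finset.sum_image fun i _ j _ h => e2_injective m h, hs]
        have : ∑ i : Fin m, (b i : ℝ) * r2 m i = ∑ i ∈ S, r2 m i := by
          rw [Finset.sum_filter]
          refine Finset.sum_congr rfl fun i _ => ?_
          rcases hb i with h | h <;> simp [h]
        rw [this, coe_finset_sum']
        rfl
      rw [hsum]
      have hqs : (q : ℝ) / (-2) ^ m = s + c := by
        have : (q : ℝ) = (∑ i ∈ Finset.range m, (b i : ℝ) * (-2) ^ i) + c * (-2) ^ m := by
          rw [hc]; push_cast; rfl
        rw [this, add_div, mul_div_cancel_right₀ _ hpm, hs, Finset.sum_div]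
        congr 1
        rw [Finset.sum_range (fun i => (b i : ℝ) * (-2) ^ i / (-2) ^ m)]
        refine Finset.sum_congr rfl fun i _ => ?_
        unfold r2; ring
      have hdist : dist ((y : ℝ) : AddCircle (1 : ℝ)) ((s : ℝ) : AddCircle (1 : ℝ))
          = ‖(((y - s - c : ℝ)) : AddCircle (1 : ℝ))‖ := by
        rw [dist_eq_norm, ← AddCircle.coe_sub]
        congr 1
        rw [sub_sub, AddCircle.coe_sub, AddCircle.coe_sub, AddCircle.coe_add]
        have hc0 : ((c : ℝ) : AddCircle (1 : ℝ)) = 0 := by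
          rw [AddCircle.coe_eq_zero_iff]
          exact ⟨c, by simp⟩
        rw [hc0, add_zero]
      rw [hdist]
      calc ‖(((y - s - c : ℝ)) : AddCircle (1 : ℝ))‖ ≤ ‖y - s - c‖ :=
              QuotientAddGroup.norm_mk_le_norm
        _ = |((-2 : ℝ) ^ m) * y - q| / 2 ^ m := by
              rw [Real.norm_eq_abs]
              have : y - s - c = (((-2 : ℝ) ^ m) * y - q) / (-2) ^ m := by
                field_simp
                have := hqs
                field_simp at this
                linarith
              rw [this, abs_div, abs_pow, abs_neg, abs_two]
        _ ≤ (1 / 2) / 2 ^ m := by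
              gcongr
              exact abs_sub_round _
        _ = 1 / 2 ^ (m + 1) := by rw [pow_succ]; ring
        _ ≤ lam := hlo

end Upper

/-- **Prop. 4.2 of Connes–Consani 2024, PROVED**: `dim_𝕊 U(1)_λ = m` if `2^{-m-1} ≤ λ < 2^{-m}`
(and `= 0` if `λ ≥ 1/2`, `sTolDim_eq_zero`). [cite: ConnesConsani2024RiemannRochZ, Prop. 4.2 p. 5] -/
theorem sTolDim_U1_eq (m : ℕ) {lam : ℝ} (hlo : 1 / (2 : ℝ) ^ (m + 1) ≤ lam)
    (hhi : lam < 1 / (2 : ℝ) ^ m) : sTolDim (AddCircle (1 : ℝ)) lam = m := by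
  have hlam : 0 ≤ lam := le_trans (by positivity) hlo
  have hgen := sTolGenerates_Fm2 m hlo hhi
  apply le_antisymm
  · simpa [card_Fm2] using sTolDim_le_card hgen
  · exact le_sTolDim ⟨_, hgen⟩ fun F hF => le_card_of_sTolGenerates hlam hhi hF

end Literature.NumberTheory.ConnesConsani2023

end
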